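import Summits.NavierStokesRegularity.NavierStokesRegularity.Theorems.SoloSalvageWu2026CutoffProfile
import HarnessLib

/-!
# C177 `Wu2026` — SALVAGE (TRUE column), tool for (3.82): the radial lift `h_{R,ε}(x) = g_{R,ε}(|x|²)`
# of the superharmonic profile to `ℝ³`

Cell `ns-claims` (D-0090), lane ns-claims-salvage-p6 g5; continuation of `SoloSalvageWu2026CutoffProfile`
(the 1-D profile `profile R ε`). Here: `radialProfile R ε x = profile R ε (‖x‖²)` is `C²` with
`0 ≤ h ≤ 1`, `h ≤ R/|x|`, `h = R/|x|` for `|x| ≥ R+ε`, `h =` plateau on `B_R`, gradient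
`Dh(x)·w = −R·rampDens(|x|²)⟪x,w⟫` (`= 0` on `B_R`, `|Dh(x)·w| ≤ R|x|^{−2}‖w‖`), and **`Δh ≤ 0` everywhere**
by the radial Laplacian formula `Δ(g∘|·|²) = 4σg″ + 6g′` (`RadialCalculus.laplacian_comp_norm_sq`) and
`4σg″ + 6g′ = −2Rθ′(σ)σ^{−1/2} ≤ 0`. This replaces the print's negative surface measure
`ΔΦ_R = −R⁻¹H²⌊S_R` (3.80) by a genuine pointwise sign. [cite: Wu2026, (3.79)–(3.80) p.24; p.25 l.15–20]

WHAT THIS IS NOT: not a claim about NS regularity or blow-up; not a claim about any author beyond the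
typed locator.
-/

set_option linter.dupNamespace false

noncomputable section

open MeasureTheory Set Filter Topology InnerProductSpace
open scoped RealInnerProductSpace Laplacian Topology

namespace Summit.NavierStokesRegularity.NavierStokesRegularity.Theorems.Wu2026Salvage

open Literature.Analysis.FluidPDE Literature.Claims.NS.Wu2026

/-! ### §4 The lift to `ℝ³`: `h_{R,ε}(x) = g_{R,ε}(|x|²)` -/

/-- The smooth superharmonic radial profile `h_{R,ε}(x) = g_{R,ε}(|x|²)` (the file docstring's
`Φ_{R,ε}`). [cite: Wu2026, p.25 l.15–20 (Φ_{R,ε})] -/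
def radialProfile (R ε : ℝ) (x : E3) : ℝ := profile R ε (‖x‖ ^ 2)

/-- `h_{R,ε}` is `C²`. [cite: Wu2026, p.25 l.15–20] -/
theorem contDiff_radialProfile {R ε : ℝ} (hR : 0 < R) (hε : 0 < ε) : ContDiff ℝ 2 (radialProfile R ε) :=
  (contDiff_profile hR hε (n := 2)).comp (contDiff_norm_sq ℝ)

/-- `0 ≤ h_{R,ε} ≤ 1`. [cite: Wu2026, (3.79) p.24] -/
theorem radialProfile_nonneg_le_one {R ε : ℝ} (hR : 0 < R) (hε : 0 < ε) (x : E3) :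
    0 ≤ radialProfile R ε x ∧ radialProfile R ε x ≤ 1 :=
  ⟨profile_nonneg hR hε _, profile_le_one hR hε _⟩

/-- `h_{R,ε}(x) ≤ R/|x|` for `x ≠ 0`. [cite: Wu2026, p.25 l.24 (Φ_R ≤ CR/L on A_L)] -/
theorem radialProfile_le_div {R ε : ℝ} (hR : 0 < R) (hε : 0 < ε) {x : E3} (hx : x ≠ 0) :
    radialProfile R ε x ≤ R / ‖x‖ := by
  have hx0 : 0 < ‖x‖ := norm_pos_iff.2 hx
  have h := profile_le_tail (R := R) (ε := ε) hR hε (σ := ‖x‖ ^ 2) (by positivity)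
  have e : (‖x‖ ^ 2 : ℝ) ^ (-(1 / 2 : ℝ)) = ‖x‖⁻¹ := by
    rw [Real.rpow_neg (by positivity), show (‖x‖ ^ 2 : ℝ) = ‖x‖ ^ (2 : ℝ) by norm_cast,
      ← Real.rpow_mul hx0.le]
    norm_num
  rw [radialProfile, div_eq_mul_inv]
  rwa [e] at h

/-- `h_{R,ε}(x) = R/|x|` for `|x| ≥ R + ε`. [cite: Wu2026, (3.79) p.24] -/
theorem radialProfile_eq_div {R ε : ℝ} (hR : 0 < R) (hε : 0 < ε) {x : E3} (hx : R + ε ≤ ‖x‖) :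
    radialProfile R ε x = R / ‖x‖ := by
  have hRe : 0 < R + ε := by linarith
  have hx0 : 0 < ‖x‖ := hRe.trans_le hx
  have hsq : (R + ε) ^ 2 ≤ ‖x‖ ^ 2 := pow_le_pow_left₀ hRe.le hx 2
  rw [radialProfile, profile_eq_of_le hR hε hsq, Real.rpow_neg (by positivity),
    show (‖x‖ ^ 2 : ℝ) = ‖x‖ ^ (2 : ℝ) by norm_cast, ← Real.rpow_mul hx0.le]
  norm_num
  rw [div_eq_mul_inv]

/-- `h_{R,ε}(x) = g(R²)` (the plateau) for `|x| ≤ R`. [cite: Wu2026, (3.79) p.24] -/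
theorem radialProfile_eq_plateau {R ε : ℝ} (hR : 0 < R) (hε : 0 < ε) {x : E3} (hx : ‖x‖ ≤ R) :
    radialProfile R ε x = profile R ε (R ^ 2) :=
  profile_eq_of_le_sq hR hε (pow_le_pow_left₀ (norm_nonneg _) hx 2)

/-- The gradient: `Dh_{R,ε}(x)·w = −R θ(|x|²)(|x|²)^{−3/2} ⟪x, w⟫`. [cite: Wu2026, (3.80) p.24 (∇Φ_R)] -/
theorem fderiv_radialProfile_apply {R ε : ℝ} (hR : 0 < R) (hε : 0 < ε) (x w : E3) :
    fderiv ℝ (radialProfile R ε) x w = -(R * rampDens R ε (‖x‖ ^ 2)) * ⟪x, w⟫ := by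
  have h := fderiv_comp_norm_sq_apply (hasDerivAt_profile hR hε (‖x‖ ^ 2)) w
  rw [show (fun w : E3 => profile R ε (‖w‖ ^ 2)) = radialProfile R ε from rfl] at h
  rw [h]; ring

/-- `Dh_{R,ε} = 0` on `B_R`. [cite: Wu2026, (3.80) p.24] -/
theorem fderiv_radialProfile_eq_zero {R ε : ℝ} (hR : 0 < R) (hε : 0 < ε) {x : E3} (hx : ‖x‖ ≤ R)
    (w : E3) : fderiv ℝ (radialProfile R ε) x w = 0 := by
  rw [fderiv_radialProfile_apply hR hε, rampDens_eq_zero hR hε (pow_le_pow_left₀ (norm_nonneg _) hx 2)]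
  ring

/-- Gradient bound `|Dh_{R,ε}(x)·w| ≤ R|x|^{−2}‖w‖` (`x ≠ 0`). [cite: Wu2026, p.25 l.24 (|∇Φ_R| ≤ CR/L²)] -/
theorem abs_fderiv_radialProfile_le {R ε : ℝ} (hR : 0 < R) (hε : 0 < ε) {x : E3} (hx : x ≠ 0) (w : E3) :
    |fderiv ℝ (radialProfile R ε) x w| ≤ R / ‖x‖ ^ 2 * ‖w‖ := by
  have hx0 : 0 < ‖x‖ := norm_pos_iff.2 hx
  have hσ : 0 < ‖x‖ ^ 2 := by positivity
  rw [fderiv_radialProfile_apply hR hε, abs_mul, abs_neg, abs_of_nonneg (mul_nonneg hR.le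
    (rampDens_nonneg hR hε _))]
  have h1 : rampDens R ε (‖x‖ ^ 2) ≤ (‖x‖ ^ 2) ^ (-(3 / 2 : ℝ)) := rampDens_le_rpow hσ
  have e : (‖x‖ ^ 2 : ℝ) ^ (-(3 / 2 : ℝ)) = (‖x‖ ^ 3)⁻¹ := by
    rw [Real.rpow_neg hσ.le, show (‖x‖ ^ 2 : ℝ) = ‖x‖ ^ (2 : ℝ) by norm_cast, ← Real.rpow_mul hx0.le,
      show (2 : ℝ) * (3 / 2) = (3 : ℕ) by norm_num, Real.rpow_natCast]
  rw [e] at h1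
  calc R * rampDens R ε (‖x‖ ^ 2) * |⟪x, w⟫| ≤ R * (‖x‖ ^ 3)⁻¹ * (‖x‖ * ‖w‖) := by
        gcongr
        exact abs_real_inner_le_norm _ _
    _ = R / ‖x‖ ^ 2 * ‖w‖ := by field_simp

/-- Operator-norm form of the gradient bound. [cite: Wu2026, p.25 l.24] -/
theorem norm_fderiv_radialProfile_le {R ε : ℝ} (hR : 0 < R) (hε : 0 < ε) {x : E3} (hx : x ≠ 0) :
    ‖fderiv ℝ (radialProfile R ε) x‖ ≤ R / ‖x‖ ^ 2 :=
  ContinuousLinearMap.opNorm_le_bound _ (by positivity) fun w => by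
    rw [Real.norm_eq_abs]; exact abs_fderiv_radialProfile_le hR hε hx w

/-- **`Δh_{R,ε} ≤ 0` everywhere** (`= −2Rθ′(|x|²)/|x|` off the origin, `= 0` on `B_R`).
[cite: Wu2026, (3.80) p.24 (ΔΦ_R = −R⁻¹H²⌊S_R ≤ 0)] -/
theorem laplacian_radialProfile_nonpos {R ε : ℝ} (hR : 0 < R) (hε : 0 < ε) (x : E3) :
    (Δ (radialProfile R ε)) x ≤ 0 := by
  have hform := laplacian_comp_norm_sq (E := E3) (g := profile R ε)
    (g₁ := fun s => -(R / 2 * rampDens R ε s)) (g₂ := profileDD R ε (‖x‖ ^ 2)) (U := univ)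
    isOpen_univ (fun σ _ => hasDerivAt_profile hR hε σ) (z := x) (mem_univ _)
    (hasDerivAt_deriv_profile hR hε (‖x‖ ^ 2))
  rw [show (fun w : E3 => profile R ε (‖w‖ ^ 2)) = radialProfile R ε from rfl] at hform
  rw [hform, finrank_euclideanSpace_fin]
  by_cases hx : x = 0
  · subst hx
    have h0 : rampDens R ε 0 = 0 := rampDens_eq_zero hR hε (by positivity)
    simp [h0]
  · have hσ : 0 < ‖x‖ ^ 2 := by positivity
    have h := radial_laplacian_identity (R := R) (ε := ε) hσ
    have e : (4 : ℝ) * profileDD R ε (‖x‖ ^ 2) * ‖x‖ ^ 2 + 2 * ((3 : ℕ) : ℝ) * -(R / 2 * rampDens R ε (‖x‖ ^ 2))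
        = -(2 * R * deriv (ramp R ε) (‖x‖ ^ 2) * (‖x‖ ^ 2) ^ (-(1 / 2 : ℝ))) := by exact_mod_cast h
    rw [e, neg_nonpos]
    have := deriv_ramp_nonneg hR hε (‖x‖ ^ 2)
    positivity

end Summit.NavierStokesRegularity.NavierStokesRegularity.Theorems.Wu2026Salvage

end

-- WHAT THIS IS NOT: not a claim about NS regularity or blow-up; not a claim about any author beyond the typed locator.
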